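import Summits.Ventures.PercRepro.C041BlockMapSubdiv

/-!
# ROW C-041 — REDUCTIONS OF THE BLOCK MAP: a loop doubles it, a pendant edge at a new vertex doubles it, and the
loopified host is twice the host with the edge deleted (p6, gen 34; with THEOREM (SUBDIVISION) of
`C041BlockMapSubdiv`: `Θ_{Z₁ with e₀ subdivided} = Θ_{Z₁} + 2·Θ_{Z₁ − e₀}`, mine-3's §21 (a) for every host)

Setting of `C041BlockMapSubdiv`.  Three host surgeries that do not change the statuses of the old vertices:
`addLoop Z₁ x` (a new loop `none` at `x`), `addPendant Z₁ x` (a new vertex `none` joined to `x` by the new edge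
`none`) and `del Z₁ e₀` (the edge `e₀` deleted; edges `{e // e ≠ e₀}`), against `loopify Z₁ e₀`.  In each case a
monochromatic path between old vertices is a monochromatic path of the smaller host (`reflTransGen_addLoop_iff`,
`reflTransGen_addPendant_iff`, `reflTransGen_loopify_iff`: a loop is never a step between distinct vertices, a path
through a pendant vertex enters and leaves by the same edge), so the colouring term does not see the extra edge,
whose two colours give the factor `2`: **`blockMap_addLoop`**, **`blockMap_addPendant`**, **`blockMap_loopify`**
(`= 2 • blockMap (del Z₁ e₀)`), and **`blockMap_subdiv_del`**: `Θ_{subdiv} = Θ_{Z₁} + 2 • Θ_{Z₁ − e₀}`.  Hence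
the cone conjecture for block maps is closed under adding loops and pendant vertices, and a block map with a
non-terminal vertex of degree `≤ 2` reduces to smaller hosts: CONJECTURE (BLOCK MAP) for every host follows from
the hosts whose non-terminal vertices have degree `≥ 3`, by induction on the number of edges.
-/

namespace PercRepro

namespace ZoneZ

namespace MultiExit

open ZoneData Pendant Finset TwoExit TreeClosure

variable {V₁ E₁ U₁ U₂ : Type} (Z₁ : ZoneData V₁ E₁ U₁ U₂)

/-! ## A loop at an old vertex -/

section Loop

variable (x : V₁)

/-- The host with a new LOOP `none` at `x`. -/
def addLoop : ZoneData V₁ (Option E₁) U₁ U₂ where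
  fst := fun e => match e with
    | some e => Z₁.fst e
    | none => x
  snd := fun e => match e with
    | some e => Z₁.snd e
    | none => x
  at₁ := Z₁.at₁
  at₂ := Z₁.at₂

/-- `Joins` of an old edge in the host with a loop. -/
theorem addLoop_joins_some (e : E₁) (v v' : V₁) : (addLoop Z₁ x).Joins (some e) v v' ↔ Z₁.Joins e v v' :=
  Iff.rfl

/-- `Joins` of the loop: both ends are `x`. -/
theorem addLoop_joins_none (v v' : V₁) : (addLoop Z₁ x).Joins none v v' → v = v' := by
  rintro (⟨rfl, rfl⟩ | ⟨rfl, rfl⟩) <;> rfl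

/-- A monochromatic path of the host with a loop is a monochromatic path of the host. -/
theorem reflTransGen_addLoop_iff (c : Bool) (ω' : Option E₁ → Bool) (v v' : V₁) :
    Relation.ReflTransGen (cAdj (addLoop Z₁ x) c ω') v v' ↔
      Relation.ReflTransGen (cAdj Z₁ c fun e => ω' (some e)) v v' := by
  constructor
  · intro h
    induction h with
    | refl => exact Relation.ReflTransGen.refl
    | tail _ hstep ih =>
      obtain ⟨e, hj, hc⟩ := hstep
      rcases e with _ | e
      · rw [addLoop_joins_none Z₁ x _ _ hj] at ih
        exact ih
      · exact ih.tail ⟨e, hj, hc⟩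
  · intro h
    induction h with
    | refl => exact Relation.ReflTransGen.refl
    | tail _ hstep ih =>
      obtain ⟨e, hj, hc⟩ := hstep
      exact ih.tail ⟨some e, hj, hc⟩

/-- Merged status in the host with a loop. -/
theorem Mg_addLoop (ω' : Option E₁ → Bool) (v v' : V₁) :
    (addLoop Z₁ x).Mg v v' ω' ↔ Z₁.Mg v v' fun e => ω' (some e) := by
  rw [Mg_iff_reflTransGen, Mg_iff_reflTransGen]
  exact reflTransGen_addLoop_iff Z₁ x false ω' v v'

/-- Reached status in the host with a loop. -/
theorem Rd_addLoop (ω' : Option E₁ → Bool) (v v' : V₁) :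
    (addLoop Z₁ x).Rd v v' ω' ↔ Z₁.Rd v v' fun e => ω' (some e) := by
  rw [Rd_iff_reflTransGen, Rd_iff_reflTransGen]
  exact reflTransGen_addLoop_iff Z₁ x true ω' v v'

variable {ι : Type} (u : ι → V₁) (a₁ : V₁) [Fintype ι] (ω' : Option E₁ → Bool)

/-- The merged set in the host with a loop. -/
theorem merged_addLoop : merged (addLoop Z₁ x) u a₁ ω' = merged Z₁ u a₁ fun e => ω' (some e) := by
  ext k
  rw [mem_merged, mem_merged, Mg_addLoop]

/-- The blocks in the host with a loop. -/
theorem blk_addLoop : blk (addLoop Z₁ x) u a₁ ω' = blk Z₁ u a₁ fun e => ω' (some e) := by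
  funext k
  ext l
  rw [mem_blk, mem_blk, Mg_addLoop, Mg_addLoop]

/-- The blocks in the host with a loop. -/
theorem blocks_addLoop : blocks (addLoop Z₁ x) u a₁ ω' = blocks Z₁ u a₁ fun e => ω' (some e) := by
  ext B
  rw [mem_blocks, mem_blocks]
  simp only [Mg_addLoop, blk_addLoop]

/-- The colouring term does not see the loop. -/
theorem colTerm_addLoop (w : ι → Vec6) :
    colTerm (addLoop Z₁ x) u a₁ ω' w = colTerm Z₁ u a₁ (fun e => ω' (some e)) w := by
  unfold colTerm
  rw [merged_addLoop, blocks_addLoop]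
  simp only [Rd_addLoop]

variable [Fintype E₁] [DecidableEq E₁]

omit [Fintype E₁] [DecidableEq E₁] in
/-- Summing the colouring terms over the colour of the loop. -/
theorem sum_bool_colTerm_addLoop (ω : E₁ → Bool) (w : ι → Vec6) :
    ∑ b : Bool, colTerm (addLoop Z₁ x) u a₁ (extCol ω b) w = (2 : ℝ) • colTerm Z₁ u a₁ ω w := by
  rw [Fintype.sum_bool, colTerm_addLoop, colTerm_addLoop, two_smul]
  rfl

/-- **A loop doubles the block map.** -/
theorem blockMap_addLoop (w : ι → Vec6) : blockMap (addLoop Z₁ x) u a₁ w = (2 : ℝ) • blockMap Z₁ u a₁ w := by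
  rw [blockMap_eq_sum_colTerm, blockMap_eq_sum_colTerm,
    ← Fintype.sum_equiv (extColEquiv (E₁ := E₁)) (fun p => colTerm (addLoop Z₁ x) u a₁ (extColEquiv p) w) _
      (fun _ => rfl),
    Fintype.sum_prod_type, Finset.smul_sum]
  exact Finset.sum_congr rfl fun ω _ => sum_bool_colTerm_addLoop Z₁ x u a₁ ω w

end Loop

/-! ## A pendant edge to a new vertex -/

section Pendant

variable (x : V₁)

/-- The host with a new vertex `none` joined to `x` by the new edge `none`. -/
def addPendant : ZoneData (Option V₁) (Option E₁) U₁ U₂ where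
  fst := fun e => match e with
    | some e => some (Z₁.fst e)
    | none => some x
  snd := fun e => match e with
    | some e => some (Z₁.snd e)
    | none => none
  at₁ := fun t => some (Z₁.at₁ t)
  at₂ := fun t => some (Z₁.at₂ t)

/-- `Joins` of an old edge in the host with a pendant edge. -/
theorem addPendant_joins_some (e : E₁) (z z' : Option V₁) :
    (addPendant Z₁ x).Joins (some e) z z' ↔ ∃ v v', z = some v ∧ z' = some v' ∧ Z₁.Joins e v v' := by
  unfold Joins
  constructor
  · rintro (⟨h1, h2⟩ | ⟨h1, h2⟩)
    · exact ⟨_, _, h1.symm, h2.symm, Or.inl ⟨rfl, rfl⟩⟩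
    · exact ⟨_, _, h2.symm, h1.symm, Or.inr ⟨rfl, rfl⟩⟩
  · rintro ⟨v, v', rfl, rfl, (⟨rfl, rfl⟩ | ⟨rfl, rfl⟩)⟩
    · exact Or.inl ⟨rfl, rfl⟩
    · exact Or.inr ⟨rfl, rfl⟩

/-- `Joins` of the pendant edge. -/
theorem addPendant_joins_none (z z' : Option V₁) :
    (addPendant Z₁ x).Joins none z z' ↔ (z = some x ∧ z' = none) ∨ (z = none ∧ z' = some x) := by
  unfold Joins
  constructor
  · rintro (⟨h1, h2⟩ | ⟨h1, h2⟩)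
    · exact Or.inl ⟨h1.symm, h2.symm⟩
    · exact Or.inr ⟨h2.symm, h1.symm⟩
  · rintro (⟨rfl, rfl⟩ | ⟨rfl, rfl⟩)
    · exact Or.inl ⟨rfl, rfl⟩
    · exact Or.inr ⟨rfl, rfl⟩

/-- A monochromatic path between old vertices of the host with a pendant edge is a monochromatic path of the
host. -/
theorem reflTransGen_addPendant_iff (c : Bool) (ω' : Option E₁ → Bool) (v v' : V₁) :
    Relation.ReflTransGen (cAdj (addPendant Z₁ x) c ω') (some v) (some v') ↔
      Relation.ReflTransGen (cAdj Z₁ c fun e => ω' (some e)) v v' := by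
  constructor
  · intro h
    have key : ∀ z, Relation.ReflTransGen (cAdj (addPendant Z₁ x) c ω') (some v) z →
        (∀ y, z = some y → Relation.ReflTransGen (cAdj Z₁ c fun e => ω' (some e)) v y) ∧
        (z = none → Relation.ReflTransGen (cAdj Z₁ c fun e => ω' (some e)) v x) := by
      intro z hz
      induction hz with
      | refl =>
        refine ⟨fun y hy => ?_, fun hn => absurd hn (Option.some_ne_none v)⟩
        cases hy
        exact Relation.ReflTransGen.refl
      | tail _ hstep ih =>
        obtain ⟨e, hj, hc⟩ := hstep
        rcases e with _ | e
        · rw [addPendant_joins_none] at hj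
          rcases hj with ⟨rfl, rfl⟩ | ⟨rfl, rfl⟩
          · exact ⟨fun y hy => (nomatch hy), fun _ => ih.1 x rfl⟩
          · refine ⟨fun y hy => ?_, fun hn => absurd hn (Option.some_ne_none _)⟩
            cases hy
            exact ih.2 rfl
        · rw [addPendant_joins_some] at hj
          obtain ⟨y, y', rfl, rfl, hyy'⟩ := hj
          refine ⟨fun y'' hy'' => ?_, fun hn => absurd hn (Option.some_ne_none _)⟩
          cases hy''
          exact (ih.1 y rfl).tail ⟨e, hyy', hc⟩
    exact (key _ h).1 v' rfl
  · intro h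
    induction h with
    | refl => exact Relation.ReflTransGen.refl
    | tail hpath hstep ih =>
      rename_i y y'
      obtain ⟨e, hj, hc⟩ := hstep
      exact ih.tail ⟨some e, (addPendant_joins_some Z₁ x e _ _).2 ⟨y, y', rfl, rfl, hj⟩, hc⟩

/-- Merged status of old vertices in the host with a pendant edge. -/
theorem Mg_addPendant (ω' : Option E₁ → Bool) (v v' : V₁) :
    (addPendant Z₁ x).Mg (some v) (some v') ω' ↔ Z₁.Mg v v' fun e => ω' (some e) := by
  rw [Mg_iff_reflTransGen, Mg_iff_reflTransGen]
  exact reflTransGen_addPendant_iff Z₁ x false ω' v v'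

/-- Reached status of old vertices in the host with a pendant edge. -/
theorem Rd_addPendant (ω' : Option E₁ → Bool) (v v' : V₁) :
    (addPendant Z₁ x).Rd (some v) (some v') ω' ↔ Z₁.Rd v v' fun e => ω' (some e) := by
  rw [Rd_iff_reflTransGen, Rd_iff_reflTransGen]
  exact reflTransGen_addPendant_iff Z₁ x true ω' v v'

variable {ι : Type} (u : ι → V₁) (a₁ : V₁) [Fintype ι] (ω' : Option E₁ → Bool)

/-- The merged set in the host with a pendant edge. -/
theorem merged_addPendant :
    merged (addPendant Z₁ x) (fun k => some (u k)) (some a₁) ω' = merged Z₁ u a₁ fun e => ω' (some e) := by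
  ext k
  rw [mem_merged, mem_merged, Mg_addPendant]

/-- The blocks in the host with a pendant edge. -/
theorem blk_addPendant :
    blk (addPendant Z₁ x) (fun k => some (u k)) (some a₁) ω' = blk Z₁ u a₁ fun e => ω' (some e) := by
  funext k
  ext l
  rw [mem_blk, mem_blk, Mg_addPendant, Mg_addPendant]

/-- The blocks in the host with a pendant edge. -/
theorem blocks_addPendant :
    blocks (addPendant Z₁ x) (fun k => some (u k)) (some a₁) ω' = blocks Z₁ u a₁ fun e => ω' (some e) := by
  ext B
  rw [mem_blocks, mem_blocks]
  simp only [Mg_addPendant, blk_addPendant]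

/-- The colouring term does not see the pendant edge. -/
theorem colTerm_addPendant (w : ι → Vec6) :
    colTerm (addPendant Z₁ x) (fun k => some (u k)) (some a₁) ω' w =
      colTerm Z₁ u a₁ (fun e => ω' (some e)) w := by
  unfold colTerm
  rw [merged_addPendant, blocks_addPendant]
  simp only [Rd_addPendant]

variable [Fintype E₁] [DecidableEq E₁]

omit [Fintype E₁] [DecidableEq E₁] in
/-- Summing the colouring terms over the colour of the pendant edge. -/
theorem sum_bool_colTerm_addPendant (ω : E₁ → Bool) (w : ι → Vec6) :
    ∑ b : Bool, colTerm (addPendant Z₁ x) (fun k => some (u k)) (some a₁) (extCol ω b) w =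
      (2 : ℝ) • colTerm Z₁ u a₁ ω w := by
  rw [Fintype.sum_bool, colTerm_addPendant, colTerm_addPendant, two_smul]
  rfl

/-- **A pendant edge to a new vertex doubles the block map.** -/
theorem blockMap_addPendant (w : ι → Vec6) :
    blockMap (addPendant Z₁ x) (fun k => some (u k)) (some a₁) w = (2 : ℝ) • blockMap Z₁ u a₁ w := by
  rw [blockMap_eq_sum_colTerm, blockMap_eq_sum_colTerm,
    ← Fintype.sum_equiv (extColEquiv (E₁ := E₁))
      (fun p => colTerm (addPendant Z₁ x) (fun k => some (u k)) (some a₁) (extColEquiv p) w) _ (fun _ => rfl),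
    Fintype.sum_prod_type, Finset.smul_sum]
  exact Finset.sum_congr rfl fun ω _ => sum_bool_colTerm_addPendant Z₁ x u a₁ ω w

end Pendant

/-! ## The deleted edge against the loop -/

section Del

variable (e₀ : E₁) [DecidableEq E₁]

/-- The host with the edge `e₀` DELETED. -/
def del : ZoneData V₁ {e // e ≠ e₀} U₁ U₂ where
  fst := fun e => Z₁.fst e.1
  snd := fun e => Z₁.snd e.1
  at₁ := Z₁.at₁
  at₂ := Z₁.at₂

omit [DecidableEq E₁] in
/-- `Joins` in the deleted host. -/
theorem del_joins (e : {e // e ≠ e₀}) (v v' : V₁) : (del Z₁ e₀).Joins e v v' ↔ Z₁.Joins e.1 v v' := Iff.rfl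

/-- A monochromatic path of the loopified host is a monochromatic path of the deleted host. -/
theorem reflTransGen_loopify_iff (c : Bool) (ω : E₁ → Bool) (v v' : V₁) :
    Relation.ReflTransGen (cAdj (loopify Z₁ e₀) c ω) v v' ↔
      Relation.ReflTransGen (cAdj (del Z₁ e₀) c fun e => ω e.1) v v' := by
  constructor
  · intro h
    induction h with
    | refl => exact Relation.ReflTransGen.refl
    | tail _ hstep ih =>
      obtain ⟨e, hj, hc⟩ := hstep
      by_cases he : e = e₀
      · subst he
        rw [loopify_joins_self Z₁ e _ _ hj] at ih
        exact ih
      · exact ih.tail ⟨⟨e, he⟩, (del_joins Z₁ e₀ ⟨e, he⟩ _ _).2 ((loopify_joins_of_ne Z₁ e₀ he _ _).1 hj), hc⟩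
  · intro h
    induction h with
    | refl => exact Relation.ReflTransGen.refl
    | tail _ hstep ih =>
      obtain ⟨e, hj, hc⟩ := hstep
      exact ih.tail ⟨e.1, (loopify_joins_of_ne Z₁ e₀ e.2 _ _).2 ((del_joins Z₁ e₀ e _ _).1 hj), hc⟩

/-- Merged status in the loopified host. -/
theorem Mg_loopify (ω : E₁ → Bool) (v v' : V₁) :
    (loopify Z₁ e₀).Mg v v' ω ↔ (del Z₁ e₀).Mg v v' fun e => ω e.1 := by
  rw [Mg_iff_reflTransGen, Mg_iff_reflTransGen]
  exact reflTransGen_loopify_iff Z₁ e₀ false ω v v'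

/-- Reached status in the loopified host. -/
theorem Rd_loopify (ω : E₁ → Bool) (v v' : V₁) :
    (loopify Z₁ e₀).Rd v v' ω ↔ (del Z₁ e₀).Rd v v' fun e => ω e.1 := by
  rw [Rd_iff_reflTransGen, Rd_iff_reflTransGen]
  exact reflTransGen_loopify_iff Z₁ e₀ true ω v v'

variable {ι : Type} (u : ι → V₁) (a₁ : V₁) [Fintype ι] (ω : E₁ → Bool)

/-- The merged set in the loopified host. -/
theorem merged_loopify : merged (loopify Z₁ e₀) u a₁ ω = merged (del Z₁ e₀) u a₁ fun e => ω e.1 := by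
  ext k
  rw [mem_merged, mem_merged, Mg_loopify]

/-- The blocks in the loopified host. -/
theorem blk_loopify : blk (loopify Z₁ e₀) u a₁ ω = blk (del Z₁ e₀) u a₁ fun e => ω e.1 := by
  funext k
  ext l
  rw [mem_blk, mem_blk, Mg_loopify, Mg_loopify]

/-- The blocks in the loopified host. -/
theorem blocks_loopify : blocks (loopify Z₁ e₀) u a₁ ω = blocks (del Z₁ e₀) u a₁ fun e => ω e.1 := by
  ext B
  rw [mem_blocks, mem_blocks]
  simp only [Mg_loopify, blk_loopify]

/-- The colouring term of the loopified host is that of the deleted host. -/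
theorem colTerm_loopify (w : ι → Vec6) :
    colTerm (loopify Z₁ e₀) u a₁ ω w = colTerm (del Z₁ e₀) u a₁ (fun e => ω e.1) w := by
  unfold colTerm
  rw [merged_loopify, blocks_loopify]
  simp only [Rd_loopify]

/-- The restriction of a colouring split at `e₀` to the other edges. -/
theorem funSplitAt_symm_restrict (b : Bool) (ω₀ : {e // e ≠ e₀} → Bool) :
    (fun e : {e // e ≠ e₀} => (Equiv.funSplitAt e₀ Bool).symm (b, ω₀) e.1) = ω₀ := by
  funext e
  rw [Equiv.funSplitAt_symm_apply, dif_neg e.2]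

variable [Fintype E₁]

/-- **The loopified host is twice the deleted host.** -/
theorem blockMap_loopify (w : ι → Vec6) :
    blockMap (loopify Z₁ e₀) u a₁ w = (2 : ℝ) • blockMap (del Z₁ e₀) u a₁ w := by
  rw [blockMap_eq_sum_colTerm, blockMap_eq_sum_colTerm,
    ← Fintype.sum_equiv (Equiv.funSplitAt e₀ Bool).symm
      (fun p => colTerm (loopify Z₁ e₀) u a₁ ((Equiv.funSplitAt e₀ Bool).symm p) w) _ (fun _ => rfl),
    Fintype.sum_prod_type, Fintype.sum_bool, ← Finset.sum_add_distrib, Finset.smul_sum]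
  refine Finset.sum_congr rfl fun ω₀ _ => ?_
  rw [colTerm_loopify, colTerm_loopify, funSplitAt_symm_restrict, funSplitAt_symm_restrict, two_smul]

/-- **THEOREM (SUBDIVISION), deletion form**: `Θ_{Z₁ with e₀ subdivided} = Θ_{Z₁} + 2·Θ_{Z₁ − e₀}`. -/
theorem blockMap_subdiv_del (w : ι → Vec6) :
    blockMap (subdiv Z₁ e₀) (fun k => some (u k)) (some a₁) w =
      blockMap Z₁ u a₁ w + (2 : ℝ) • blockMap (del Z₁ e₀) u a₁ w := by
  rw [blockMap_subdiv, blockMap_loopify]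

/-- **The cone conjecture for block maps is closed under subdivision**, deletion form. -/
theorem inCone_blockMap_subdiv_del (w : ι → Vec6) (h₁ : InCone (blockMap Z₁ u a₁ w))
    (h₂ : InCone (blockMap (del Z₁ e₀) u a₁ w)) :
    InCone (blockMap (subdiv Z₁ e₀) (fun k => some (u k)) (some a₁) w) := by
  rw [blockMap_subdiv_del]
  exact h₁.add (h₂.smul 2 (by norm_num))

end Del

end MultiExit

end ZoneZ

end PercRepro
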